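import Mathlib
import Summits.KontsevichZagierPeriods.KontsevichZagierPeriods.Theorems.SoloInformedLRData
import HarnessLib

/-!
# Solo-informed (A390-ii): the weighted fibre bound over the base of a prepared band

File F4d of the KERNEL LEMMA I programme.  Over a point `w` of the base `B` of a band
`bandOver B ξ j` on which `F` and a finite family `ρᵢ` are Lion–Rolin prepared (data `d₀`, `dᵢ`),
the one-variable log-room theorem (file 534) bounds the weighted fibre integral by the fibre mass:

`∫_{J(w)} F (1 + Σᵢ |log ρᵢ|)ᵖ dy ≤ C · Λ(w)ᵖ · ∫_{J(w)} |F| dy`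

with `Λ(w)` (`soloInformedBandLambda`) an explicit function of the data at `w`, itself bounded by
`C₂ (1 + Σₓ |log σₓ(w)|)` for the finite family `σ = (aᵢ, θᵢ − θ, endpoint differences)`
(`soloInformedBandSigma`).  Also recorded: the two-sided comparison of the fibre mass with
`|a(w)| · I(w)`, `I(w) = ∫_{J(w)} |y − θ(w)|^r dy`, and the normalisation of `I(w)` to
`∫_{(α₀, β)} s^r ds` according to the side of the fibre on which the centre lies.
-/

open MeasureTheory Set Real
open scoped ENNReal
open Literature.ModelTheory.ExponentialFields Literature.NumberTheory.Transcendental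

namespace Summit.KontsevichZagierPeriods.KontsevichZagierPeriods.Theorems

variable {n l : ℕ} {B : Set (Fin n → ℝ)} {ξ : Fin l → (Fin n → ℝ) → ℝ} {j : Fin (l + 1)}
  {F : (Fin (n + 1) → ℝ) → ℝ} {ι : Type} [Fintype ι] {ρ : ι → (Fin (n + 1) → ℝ) → ℝ}

/-- The log-size `Λ(w)` of the prepared data over `w`:
`2 + Σᵢ (|log aᵢ w| + log cᵢ) + Σᵢ log⁺ |θᵢ w − θ w| + (endpoint data of the normalised fibre)`. -/
noncomputable def soloInformedBandLambda (d₀ : SoloInformedLRData B (bandOver B ξ j) F)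
    (d : ∀ i, SoloInformedLRData B (bandOver B ξ j) (ρ i)) (w : Fin n → ℝ) : ℝ :=
  2 + ∑ i, (|Real.log ((d i).a w)| + Real.log (d i).c) + ∑ i, log⁺ |(d i).θ w - d₀.θ w| +
    soloInformedFibreData (bandLower ξ j w) (bandUpper ξ j w) (d₀.θ w)

/-- `Λ(w) ≥ 1`. -/
theorem soloInformed_bandLambda_ge_one (d₀ : SoloInformedLRData B (bandOver B ξ j) F)
    (d : ∀ i, SoloInformedLRData B (bandOver B ξ j) (ρ i)) (w : Fin n → ℝ) :
    1 ≤ soloInformedBandLambda d₀ d w := by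
  unfold soloInformedBandLambda
  have h1 : 0 ≤ ∑ i, (|Real.log ((d i).a w)| + Real.log (d i).c) :=
    Finset.sum_nonneg fun i _ => add_nonneg (abs_nonneg _) (d i).log_c_nonneg
  have h2 : 0 ≤ ∑ i, log⁺ |(d i).θ w - d₀.θ w| := Finset.sum_nonneg fun i _ => Real.posLog_nonneg
  have h3 := soloInformed_fibreData_nonneg (bandLower ξ j w) (bandUpper ξ j w) (d₀.θ w)
  linarith

/-- The three endpoint data of the fibre recentred at `θ`: `l − θ`, `u − θ`, `u − l`
(with `EReal.toReal`, so `±∞ ↦ 0`). -/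
noncomputable def soloInformedBandEnds (ξ : Fin l → (Fin n → ℝ) → ℝ) (j : Fin (l + 1)) (θ : (Fin n → ℝ) → ℝ) :
    Fin 3 → (Fin n → ℝ) → ℝ :=
  ![fun w => (bandLower ξ j w).toReal - θ w, fun w => (bandUpper ξ j w).toReal - θ w,
    fun w => (bandUpper ξ j w).toReal - (bandLower ξ j w).toReal]

/-- The finite family `σ = (aᵢ)ᵢ, (θᵢ − θ)ᵢ, (l − θ, u − θ, u − l)` whose logarithms dominate `Λ`. -/
noncomputable def soloInformedBandSigma (d₀ : SoloInformedLRData B (bandOver B ξ j) F)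
    (d : ∀ i, SoloInformedLRData B (bandOver B ξ j) (ρ i)) : ι ⊕ (ι ⊕ Fin 3) → (Fin n → ℝ) → ℝ :=
  Sum.elim (fun i => (d i).a)
    (Sum.elim (fun i w => (d i).θ w - d₀.θ w) (soloInformedBandEnds ξ j d₀.θ))

/-- **`Λ` is log-dominated by `σ`**: `Λ(w) ≤ (4 + Σᵢ log cᵢ) · (1 + Σₓ |log σₓ(w)|)`. -/
theorem soloInformed_bandLambda_le (d₀ : SoloInformedLRData B (bandOver B ξ j) F)
    (d : ∀ i, SoloInformedLRData B (bandOver B ξ j) (ρ i)) (w : Fin n → ℝ) :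
    soloInformedBandLambda d₀ d w ≤
      (4 + ∑ i, Real.log (d i).c) * (1 + ∑ x, |Real.log (soloInformedBandSigma d₀ d x w)|) := by
  have hFD := soloInformed_fibreData_le (bandLower ξ j w) (bandUpper ξ j w) (d₀.θ w)
  have hP : ∑ i, log⁺ |(d i).θ w - d₀.θ w| ≤ ∑ i, |Real.log ((d i).θ w - d₀.θ w)| :=
    Finset.sum_le_sum fun i _ => by
      have h := soloInformed_posLog_le_abs_log |(d i).θ w - d₀.θ w|
      rwa [Real.log_abs] at h
  have hA : 0 ≤ ∑ i, |Real.log ((d i).a w)| := Finset.sum_nonneg fun i _ => abs_nonneg _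
  have hL : 0 ≤ ∑ i, Real.log (d i).c := Finset.sum_nonneg fun i _ => (d i).log_c_nonneg
  have hΘ : 0 ≤ ∑ i, |Real.log ((d i).θ w - d₀.θ w)| := Finset.sum_nonneg fun i _ => abs_nonneg _
  have hE₁ : 0 ≤ |Real.log ((bandLower ξ j w).toReal - d₀.θ w)| := abs_nonneg _
  have hE₂ : 0 ≤ |Real.log ((bandUpper ξ j w).toReal - d₀.θ w)| := abs_nonneg _
  have hE₃ : 0 ≤ |Real.log ((bandUpper ξ j w).toReal - (bandLower ξ j w).toReal)| := abs_nonneg _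
  have hsplit : ∑ i, (|Real.log ((d i).a w)| + Real.log (d i).c) =
      ∑ i, |Real.log ((d i).a w)| + ∑ i, Real.log (d i).c := Finset.sum_add_distrib
  have hσ : ∑ x, |Real.log (soloInformedBandSigma d₀ d x w)| =
      ∑ i, |Real.log ((d i).a w)| + (∑ i, |Real.log ((d i).θ w - d₀.θ w)| +
        (|Real.log ((bandLower ξ j w).toReal - d₀.θ w)| +
          |Real.log ((bandUpper ξ j w).toReal - d₀.θ w)| +
          |Real.log ((bandUpper ξ j w).toReal - (bandLower ξ j w).toReal)|)) := by
    rw [Fintype.sum_sum_type, Fintype.sum_sum_type, Fin.sum_univ_three]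
    simp only [soloInformedBandSigma, soloInformedBandEnds, Sum.elim_inl, Sum.elim_inr,
      Matrix.cons_val_zero, Matrix.cons_val_one, Matrix.cons_val_two, Matrix.head_cons,
      Matrix.tail_cons]
  unfold soloInformedBandLambda
  rw [hsplit, hσ]
  have key : 4 * (∑ i, |Real.log ((d i).a w)| + (∑ i, |Real.log ((d i).θ w - d₀.θ w)| +
        (|Real.log ((bandLower ξ j w).toReal - d₀.θ w)| +
          |Real.log ((bandUpper ξ j w).toReal - d₀.θ w)| +
          |Real.log ((bandUpper ξ j w).toReal - (bandLower ξ j w).toReal)|))) ≤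
      (4 + ∑ i, Real.log (d i).c) * (∑ i, |Real.log ((d i).a w)| +
        (∑ i, |Real.log ((d i).θ w - d₀.θ w)| +
        (|Real.log ((bandLower ξ j w).toReal - d₀.θ w)| +
          |Real.log ((bandUpper ξ j w).toReal - d₀.θ w)| +
          |Real.log ((bandUpper ξ j w).toReal - (bandLower ξ j w).toReal)|))) :=
    mul_le_mul_of_nonneg_right (by linarith) (by positivity)
  nlinarith [key, hFD, hP]

/-! ### The weighted fibre bound -/

/-- **Weighted fibre bound over a prepared band**: there is `C > 0` (depending on the exponents,
unit bounds, `p` and the size of the family) such that for every `w ∈ B`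
`∫_{J(w)} F(w,y) (1 + Σᵢ |log ρᵢ(w,y)|)ᵖ dy ≤ C Λ(w)ᵖ ∫_{J(w)} |F(w,y)| dy`. -/
theorem soloInformed_band_fibre_bound (d₀ : SoloInformedLRData B (bandOver B ξ j) F)
    (d : ∀ i, SoloInformedLRData B (bandOver B ξ j) (ρ i)) (p : ℕ) :
    ∃ C : ℝ, 0 < C ∧ ∀ w ∈ B,
      ∫⁻ y in soloInformedEIoo (bandLower ξ j w) (bandUpper ξ j w),
          ENNReal.ofReal (F (Fin.snoc w y) * (1 + ∑ i, |Real.log (ρ i (Fin.snoc w y))|) ^ p) ≤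
        ENNReal.ofReal (C * soloInformedBandLambda d₀ d w ^ p) *
          ∫⁻ y in soloInformedEIoo (bandLower ξ j w) (bandUpper ξ j w),
            ENNReal.ofReal |F (Fin.snoc w y)| := by
  classical
  obtain ⟨C, hC1, hC⟩ := soloInformed_preparedFibre_logMoment (d₀.r : ℝ) p (Fintype.card ι)
  have hR1 : (1 : ℝ) ≤ 1 + ∑ i, |((d i).r : ℝ)| :=
    le_add_of_nonneg_right (Finset.sum_nonneg fun i _ => abs_nonneg _)
  have hc0 : 0 < d₀.c := zero_lt_one.trans d₀.one_lt_c
  refine ⟨C * d₀.c ^ 2 * (1 + ∑ i, |((d i).r : ℝ)|) ^ p, by positivity, fun w hw => ?_⟩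
  by_cases hlu : bandLower ξ j w < bandUpper ξ j w
  swap
  · rw [soloInformed_EIoo_eq_empty hlu]
    simp
  let e : ι ≃ Fin (Fintype.card ι) := Fintype.equivFin ι
  have hK0 : (0 : ℝ) ≤ 1 + ∑ i, (|Real.log ((d i).a w)| + Real.log (d i).c) :=
    zero_le_one.trans (soloInformed_fibre_K_ge_one d w)
  have hR' : ∀ i : Fin (Fintype.card ι), 0 ≤ |((d (e.symm i)).r : ℝ)| ∧
      |((d (e.symm i)).r : ℝ)| ≤ 1 + ∑ x, |((d x).r : ℝ)| := fun i =>
    ⟨abs_nonneg _, by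
      have h := Finset.single_le_sum (f := fun x => |((d x).r : ℝ)|) (fun _ _ => abs_nonneg _)
        (Finset.mem_univ (e.symm i))
      linarith⟩
  have hmain := hC (bandLower ξ j w) (bandUpper ξ j w) (d₀.θ w) (d₀.a w) d₀.c
    (1 + ∑ i, (|Real.log ((d i).a w)| + Real.log (d i).c)) (1 + ∑ i, |((d i).r : ℝ)|)
    (fun i => (d (e.symm i)).θ w) (fun i => |((d (e.symm i)).r : ℝ)|)
    (fun y => F (Fin.snoc w y)) (fun y => d₀.V (Fin.snoc w y)) hlu (d₀.θ_notMem hw)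
    (fun i => (d (e.symm i)).θ_notMem hw) d₀.one_le_c hK0 hR1 hR' (d₀.fibre_eq hw)
    (d₀.fibre_V hw)
  have hsum1 : ∀ y : ℝ, ∑ i : Fin (Fintype.card ι),
      |((d (e.symm i)).r : ℝ)| * |Real.log (|y - (d (e.symm i)).θ w|)| =
        ∑ x, |((d x).r : ℝ)| * |Real.log (|y - (d x).θ w|)| := fun y =>
    Equiv.sum_comp e.symm (fun x => |((d x).r : ℝ)| * |Real.log (|y - (d x).θ w|)|)
  have hsum2 : ∑ i : Fin (Fintype.card ι), log⁺ |(d (e.symm i)).θ w - d₀.θ w| =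
      ∑ x, log⁺ |(d x).θ w - d₀.θ w| :=
    Equiv.sum_comp e.symm (fun x => log⁺ |(d x).θ w - d₀.θ w|)
  have hΛ : 1 + (1 + ∑ i, (|Real.log ((d i).a w)| + Real.log (d i).c)) +
      ∑ i : Fin (Fintype.card ι), log⁺ |(d (e.symm i)).θ w - d₀.θ w| +
        soloInformedFibreData (bandLower ξ j w) (bandUpper ξ j w) (d₀.θ w) =
      soloInformedBandLambda d₀ d w := by
    rw [hsum2]
    unfold soloInformedBandLambda
    ring
  calc ∫⁻ y in soloInformedEIoo (bandLower ξ j w) (bandUpper ξ j w),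
        ENNReal.ofReal (F (Fin.snoc w y) * (1 + ∑ i, |Real.log (ρ i (Fin.snoc w y))|) ^ p)
      ≤ ∫⁻ y in soloInformedEIoo (bandLower ξ j w) (bandUpper ξ j w),
          ENNReal.ofReal (|F (Fin.snoc w y)| *
            ((1 + ∑ i, (|Real.log ((d i).a w)| + Real.log (d i).c)) +
              ∑ i : Fin (Fintype.card ι),
                |((d (e.symm i)).r : ℝ)| * |Real.log (|y - (d (e.symm i)).θ w|)|) ^ p) := by
        refine setLIntegral_mono' (soloInformed_measurableSet_EIoo _ _) fun y hy =>
          ENNReal.ofReal_le_ofReal ?_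
        have hW := soloInformed_fibre_weight_le d hw hy
        rw [hsum1 y]
        have h0 : 0 ≤ 1 + ∑ i, |Real.log (ρ i (Fin.snoc w y))| := by positivity
        exact mul_le_mul (le_abs_self _) (pow_le_pow_left₀ h0 hW p) (by positivity)
          (abs_nonneg _)
    _ ≤ _ := hmain
    _ = ENNReal.ofReal (C * d₀.c ^ 2 * (1 + ∑ i, |((d i).r : ℝ)|) ^ p *
          soloInformedBandLambda d₀ d w ^ p) *
          ∫⁻ y in soloInformedEIoo (bandLower ξ j w) (bandUpper ξ j w),
            ENNReal.ofReal |F (Fin.snoc w y)| := by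
        rw [← hΛ]

/-! ### Fibre mass versus `|a| · I` and normalisation of `I` -/

/-- **Fibre mass comparison**: with `I(w) = ∫_{J(w)} |y − θ w|^r dy`,
`|a w| I(w) ≤ c ∫_{J(w)} |F(w,y)| dy` and `∫_{J(w)} |F(w,y)| dy ≤ c |a w| I(w)`. -/
theorem soloInformed_band_mass_bounds (d₀ : SoloInformedLRData B (bandOver B ξ j) F)
    {w : Fin n → ℝ} (hw : w ∈ B) :
    ENNReal.ofReal |d₀.a w| *
        ∫⁻ y in soloInformedEIoo (bandLower ξ j w) (bandUpper ξ j w),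
          ENNReal.ofReal (|y - d₀.θ w| ^ (d₀.r : ℝ)) ≤
      ENNReal.ofReal d₀.c *
        ∫⁻ y in soloInformedEIoo (bandLower ξ j w) (bandUpper ξ j w),
          ENNReal.ofReal |F (Fin.snoc w y)| ∧
    ∫⁻ y in soloInformedEIoo (bandLower ξ j w) (bandUpper ξ j w),
        ENNReal.ofReal |F (Fin.snoc w y)| ≤
      ENNReal.ofReal (d₀.c * |d₀.a w|) *
        ∫⁻ y in soloInformedEIoo (bandLower ξ j w) (bandUpper ξ j w),
          ENNReal.ofReal (|y - d₀.θ w| ^ (d₀.r : ℝ)) := by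
  refine ⟨soloInformed_prepared_mass_le (soloInformed_measurableSet_EIoo _ _) d₀.one_le_c
    (d₀.fibre_eq hw) (d₀.fibre_V hw), ?_⟩
  have h := soloInformed_prepared_lintegral_upper (soloInformed_measurableSet_EIoo _ _)
    (Φ := fun _ => (1 : ℝ)) d₀.one_le_c (d₀.fibre_eq hw) (d₀.fibre_V hw) (fun _ _ => zero_le_one)
  simpa only [mul_one] using h

/-- **Normalisation of `I(w)`** according to the side of the centre: over `w ∈ B` with a nonempty
fibre, either `θ w ≤ l` and `I(w) = ∫_{(l − θ, u − θ)} s^r ds`, or `u ≤ θ w` and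
`I(w) = ∫_{(θ − u, θ − l)} s^r ds`. -/
theorem soloInformed_band_I_normalised (d₀ : SoloInformedLRData B (bandOver B ξ j) F)
    {w : Fin n → ℝ} (hw : w ∈ B) (hlu : bandLower ξ j w < bandUpper ξ j w) :
    ((d₀.θ w : EReal) ≤ bandLower ξ j w ∧
      ∫⁻ y in soloInformedEIoo (bandLower ξ j w) (bandUpper ξ j w),
          ENNReal.ofReal (|y - d₀.θ w| ^ (d₀.r : ℝ)) =
        ∫⁻ s in soloInformedEIoo (((bandLower ξ j w).toReal - d₀.θ w : ℝ) : EReal)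
            (bandUpper ξ j w - d₀.θ w), ENNReal.ofReal (s ^ (d₀.r : ℝ))) ∨
    (bandUpper ξ j w ≤ (d₀.θ w : EReal) ∧
      ∫⁻ y in soloInformedEIoo (bandLower ξ j w) (bandUpper ξ j w),
          ENNReal.ofReal (|y - d₀.θ w| ^ (d₀.r : ℝ)) =
        ∫⁻ s in soloInformedEIoo ((d₀.θ w - (bandUpper ξ j w).toReal : ℝ) : EReal)
            (d₀.θ w - bandLower ξ j w), ENNReal.ofReal (s ^ (d₀.r : ℝ))) := by
  rcases soloInformed_EIoo_side (d₀.θ_notMem hw) with hθl | huθ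
  · exact Or.inl ⟨hθl, soloInformed_fibre_subst_above hθl hlu (Fin.elim0 : Fin 0 → ℝ)
      (fun s _ => ENNReal.ofReal (s ^ (d₀.r : ℝ)))⟩
  · exact Or.inr ⟨huθ, soloInformed_fibre_subst_below huθ hlu (Fin.elim0 : Fin 0 → ℝ)
      (fun s _ => ENNReal.ofReal (s ^ (d₀.r : ℝ)))⟩

end Summit.KontsevichZagierPeriods.KontsevichZagierPeriods.Theorems
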